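import Literature.Barriers.RiemannHypothesis.EpsteinZetaChowlaSelbergLineSum
import HarnessLib

/-!
# The Epstein zeta function as a sum over lattice lines (Bateman–Grosswald 1964, proof of Theorem 1)

Proof file towards `Literature.Barriers.RiemannHypothesis.BatemanGrosswald1964_thm1`
(the Chowla–Selberg formula); no new definitions. For a positive definite real form
`Q = ax² + bxy + cy²`, `k = √(4ac − b²)/(2a)`, `β = b/(2a)`, and `Re s > 1`:

* completing the square, `Q(m, n) = a((m + nβ)² + (kn)²)` (`bqfEval_eq_mul_quad`), so
  `Q(m, n)^{−s} = a^{−s} ((m + nβ)² + (kn)²)^{−s}` (`epsteinTerm_eq_of_ne_zero`);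
* `ζ_Q(s) = Σ_{n∈ℤ} Σ_{m∈ℤ} Q(m, n)^{−s}` (absolute convergence, `epsteinZeta_eq_tsum_lines`), the
  inner sums being even in `n` (`tsum_line_neg`);
* the line `n = 0`: `Σ_{m≠0} (am²)^{−s} = 2a^{−s} ζ(2s)` (`tsum_line_zero`);
* the lines `n ≥ 1`: by the `K`-Bessel expansion of `EpsteinZetaChowlaSelbergLineSum.lean`
  (`y = kn`, `α = nβ`),
  `Σ_m Q(m, n)^{−s} = a^{−s} [ (kn)^{1−2s} π^{½} Γ(s−½)/Γ(s)
      + (4π^s/Γ(s)) (kn)^{½−s} Σ_{m≥1} m^{s−½} cos(2πm nβ) K_{s−½}(2πm kn) ]` (`tsum_line_succ`);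
* hence `a^s ζ_Q(s)/2 = ζ(2s) + Σ_{n≥1} a^s Σ_m Q(m, n)^{−s}`-type bookkeeping
  (`mul_epsteinZeta_div_two_eq`), assembled into (3) in `EpsteinZetaChowlaSelberg.lean`.

## References

* [BatemanGrosswald1964] P. T. Bateman, E. Grosswald, *On Epstein's zeta function*, Acta Arith. 9
  (1964) 365–373, Theorem 1 (3)–(4) and proof.
-/

noncomputable section

open Filter Topology Real Complex

namespace Literature.Barriers.RiemannHypothesis

open Literature.Analysis.FunctionSpaces

variable {a b c : ℝ}

/-! ## Completing the square -/

/-- `k² = (4ac − b²)/(4a²)`. [cite: BatemanGrosswald1964, §1 (`k² = |d|/(4a²)`)] -/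
theorem starkK_sq (h : IsPosDefForm a b c) : starkK a b c ^ 2 = (4 * a * c - b ^ 2) / (4 * a ^ 2) := by
  unfold starkK
  rw [div_pow, Real.sq_sqrt h.four_ac_sub_sq_pos.le]
  ring

/-- **Completing the square**: `Q(m, n) = a((m + nβ)² + (kn)²)`, `β = b/(2a)`.
[cite: BatemanGrosswald1964, proof of Theorem 1] -/
theorem bqfEval_eq_mul_quad (h : IsPosDefForm a b c) (m n : ℤ) :
    bqfEval a b c (m, n) =
      a * (((m : ℝ) + (n : ℝ) * (b / (2 * a))) ^ 2 + (starkK a b c * (n : ℝ)) ^ 2) := by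
  have ha := h.a_pos.ne'
  rw [mul_pow, starkK_sq h]
  unfold bqfEval
  field_simp
  ring

/-- `Q(−m, −n) = Q(m, n)`, hence the same for the terms of `ζ_Q`. [folklore] -/
theorem epsteinTerm_neg_neg (a b c : ℝ) (s : ℂ) (m n : ℤ) :
    epsteinTerm a b c s (-m, -n) = epsteinTerm a b c s (m, n) := by
  unfold epsteinTerm
  have e : bqfEval a b c (-m, -n) = bqfEval a b c (m, n) := by
    unfold bqfEval; push_cast; ring
  have e0 : ((-m, -n) : ℤ × ℤ) = 0 ↔ ((m, n) : ℤ × ℤ) = 0 := by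
    simp [Prod.ext_iff]
  rw [e]
  by_cases hp : ((m, n) : ℤ × ℤ) = 0
  · rw [if_pos hp, if_pos (e0.2 hp)]
  · rw [if_neg hp, if_neg (fun h0 => hp (e0.1 h0))]

/-- **On a line `n ≠ 0`: `Q(m, n)^{−s} = a^{−s} ((m + nβ)² + (kn)²)^{−s}`.**
[cite: BatemanGrosswald1964, proof of Theorem 1] -/
theorem epsteinTerm_eq_of_ne_zero (h : IsPosDefForm a b c) (s : ℂ) {n : ℤ} (hn : n ≠ 0) (m : ℤ) :
    epsteinTerm a b c s (m, n) = (a : ℂ) ^ (-s) *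
      (((((m : ℝ) + (n : ℝ) * (b / (2 * a))) ^ 2 + (starkK a b c * (n : ℝ)) ^ 2 : ℝ) : ℂ)) ^ (-s) := by
  have hp : ((m, n) : ℤ × ℤ) ≠ 0 := fun h0 => hn (congrArg Prod.snd h0)
  have hq : 0 ≤ ((m : ℝ) + (n : ℝ) * (b / (2 * a))) ^ 2 + (starkK a b c * (n : ℝ)) ^ 2 := by
    positivity
  have e : epsteinTerm a b c s (m, n) = ((bqfEval a b c (m, n) : ℝ) : ℂ) ^ (-s) := if_neg hp
  rw [e, bqfEval_eq_mul_quad h m n, Complex.ofReal_mul, Complex.mul_cpow_ofReal_nonneg h.a_pos.le hq]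

/-! ## `ζ_Q` as a sum over lines -/

/-- **`ζ_Q(s) = Σ_{n∈ℤ} Σ_{m∈ℤ} Q(m, n)^{−s}`** for `Re s > 1`, the outer series being summable and
every line summable (absolute convergence, `summable_norm_epsteinTerm`). [folklore] -/
theorem epsteinZeta_eq_tsum_lines (h : IsPosDefForm a b c) {s : ℂ} (hs : 1 < s.re) :
    epsteinZeta a b c s = ∑' n : ℤ, ∑' m : ℤ, epsteinTerm a b c s (m, n) ∧
      (Summable fun n : ℤ => ∑' m : ℤ, epsteinTerm a b c s (m, n)) ∧
      ∀ n : ℤ, Summable fun m : ℤ => epsteinTerm a b c s (m, n) := by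
  have hS : Summable (epsteinTerm a b c s) := (summable_norm_epsteinTerm h hs).of_norm
  have hT : Summable fun p : ℤ × ℤ => epsteinTerm a b c s (p.2, p.1) := by
    have := hS.comp_injective (Equiv.prodComm ℤ ℤ).injective
    simpa [Function.comp_def, Prod.swap] using this
  refine ⟨?_, hT.prod, fun n => hT.prod_factor n⟩
  unfold epsteinZeta
  rw [← (Equiv.prodComm ℤ ℤ).tsum_eq (epsteinTerm a b c s), ← hT.tsum_prod]
  exact tsum_congr fun p => by simp only [Equiv.prodComm_apply, Prod.swap]

/-- The line sums are even in `n`: `Σ_m Q(m, −n)^{−s} = Σ_m Q(m, n)^{−s}` (`m ↦ −m`). [folklore] -/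
theorem tsum_line_neg (a b c : ℝ) (s : ℂ) (n : ℤ) :
    ∑' m : ℤ, epsteinTerm a b c s (m, -n) = ∑' m : ℤ, epsteinTerm a b c s (m, n) := by
  rw [← (Equiv.neg ℤ).tsum_eq (fun m => epsteinTerm a b c s (m, -n))]
  exact tsum_congr fun m => by simp only [Equiv.neg_apply]; exact epsteinTerm_neg_neg a b c s m n

/-! ## The line `n = 0` -/

/-- `((m+1)²)^{−s} = 1/(m+1)^{2s}`. [folklore] -/
theorem sq_succ_cpow_neg (s : ℂ) (m : ℕ) :
    (((((m + 1 : ℕ) : ℤ) : ℝ) ^ 2 : ℝ) : ℂ) ^ (-s) = 1 / ((m : ℂ) + 1) ^ (2 * s) := by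
  have hm : (0 : ℝ) < (((m + 1 : ℕ) : ℤ) : ℝ) := by push_cast; positivity
  rw [ofReal_sq_cpow hm, show 2 * -s = -(2 * s) by ring, Complex.cpow_neg, one_div]
  push_cast
  ring_nf

/-- **The line `n = 0`: `Σ_{m∈ℤ} Q(m, 0)^{−s} = 2a^{−s} ζ(2s)`** (`Re s > 1`; the origin term is `0`).
[cite: BatemanGrosswald1964, proof of Theorem 1] -/
theorem tsum_line_zero (h : IsPosDefForm a b c) {s : ℂ} (hs : 1 < s.re) :
    ∑' m : ℤ, epsteinTerm a b c s (m, 0) = (a : ℂ) ^ (-s) * (2 * riemannZeta (2 * s)) := by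
  obtain ⟨-, -, hline⟩ := epsteinZeta_eq_tsum_lines h hs
  have heven : Function.Even fun m : ℤ => epsteinTerm a b c s (m, 0) := by
    intro m
    simp only []
    have := epsteinTerm_neg_neg a b c s m 0
    rwa [neg_zero] at this
  rw [tsum_int_eq_zero_add_two_mul_tsum_pnat heven (hline 0)]
  have h0 : epsteinTerm a b c s ((0 : ℤ), 0) = 0 := if_pos rfl
  rw [h0, zero_add, tsum_pnat_eq_tsum_succ (f := fun m : ℕ => epsteinTerm a b c s ((m : ℤ), 0)),
    zeta_eq_tsum_one_div_nat_add_one_cpow (by simp; linarith : 1 < (2 * s).re), nsmul_eq_mul]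
  suffices H : ∑' m : ℕ, epsteinTerm a b c s (((m + 1 : ℕ) : ℤ), 0) =
      (a : ℂ) ^ (-s) * ∑' n : ℕ, 1 / ((n : ℂ) + 1) ^ (2 * s) by
    rw [H]; push_cast; ring
  rw [← tsum_mul_left]
  refine tsum_congr fun m => ?_
  have hm0 : ((((m + 1 : ℕ) : ℤ), (0 : ℤ)) : ℤ × ℤ) ≠ 0 := fun h0 => by
    have := congrArg Prod.fst h0
    simp at this
    omega
  have e : epsteinTerm a b c s (((m + 1 : ℕ) : ℤ), 0) =
      ((bqfEval a b c (((m + 1 : ℕ) : ℤ), 0) : ℝ) : ℂ) ^ (-s) := if_neg hm0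
  have eQ : bqfEval a b c (((m + 1 : ℕ) : ℤ), 0) = a * (((m + 1 : ℕ) : ℤ) : ℝ) ^ 2 := by
    unfold bqfEval; simp
  rw [e, eQ, Complex.ofReal_mul, Complex.mul_cpow_ofReal_nonneg h.a_pos.le (sq_nonneg _),
    sq_succ_cpow_neg]

/-! ## The lines `n ≥ 1` -/

/-- **The lines `n ≥ 1`** (`Re s > 1`; `y = kn`, `α = nβ` in `tsum_sq_add_sq_cpow_neg_eq`):
`Σ_m Q(m, n)^{−s} = a^{−s} [ (kn)^{1−2s} π^{½} Γ(s−½)/Γ(s)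
  + (4π^s/Γ(s)) (kn)^{½−s} Σ_{m≥1} m^{s−½} cos(2πm·nβ) K_{s−½}(2πm·kn) ]`.
[cite: BatemanGrosswald1964, proof of Theorem 1] -/
theorem tsum_line_succ (h : IsPosDefForm a b c) {s : ℂ} (hs : 1 < s.re) (n : ℕ) :
    ∑' m : ℤ, epsteinTerm a b c s (m, ((n + 1 : ℕ) : ℤ)) = (a : ℂ) ^ (-s) *
      (((starkK a b c * ((n : ℝ) + 1) : ℝ) : ℂ) ^ (1 - 2 * s) * (π : ℂ) ^ (1 / 2 : ℂ) *
          Complex.Gamma (s - 1 / 2) / Complex.Gamma s +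
        4 * (π : ℂ) ^ s / Complex.Gamma s * ((starkK a b c * ((n : ℝ) + 1) : ℝ) : ℂ) ^ (1 / 2 - s) *
          ∑' m : ℕ, ((m + 1 : ℕ) : ℂ) ^ (s - 1 / 2) *
            (Real.cos (2 * π * ((m + 1 : ℕ) : ℝ) * (((n : ℝ) + 1) * (b / (2 * a)))) : ℂ) *
            besselK (s - 1 / 2)
              ((2 * π * ((m + 1 : ℕ) : ℝ) * (starkK a b c * ((n : ℝ) + 1)) : ℝ) : ℂ)) := by
  have hn : ((n + 1 : ℕ) : ℤ) ≠ 0 := by omega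
  have hy : 0 < starkK a b c * ((n : ℝ) + 1) := mul_pos (starkK_pos h) (by positivity)
  have hs' : 1 / 2 < s.re := by linarith
  rw [← tsum_sq_add_sq_cpow_neg_eq hy (((n : ℝ) + 1) * (b / (2 * a))) hs', ← tsum_mul_left]
  refine tsum_congr fun m => ?_
  rw [epsteinTerm_eq_of_ne_zero h s hn m]
  push_cast
  ring_nf

/-! ## Bookkeeping: `a^s ζ_Q(s)/2 = ζ(2s) + Σ_{n≥1} a^s Σ_m Q(m, n)^{−s}` -/

/-- **`a^s ζ_Q(s)/2 = ζ(2s) + Σ_{n≥1} a^s Σ_m Q(m, n)^{−s}`** (`Re s > 1`), and the series on the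
right is summable. [cite: BatemanGrosswald1964, proof of Theorem 1] -/
theorem mul_epsteinZeta_div_two_eq (h : IsPosDefForm a b c) {s : ℂ} (hs : 1 < s.re) :
    (a : ℂ) ^ s * (epsteinZeta a b c s / 2) = riemannZeta (2 * s) +
        ∑' n : ℕ, (a : ℂ) ^ s * ∑' m : ℤ, epsteinTerm a b c s (m, ((n + 1 : ℕ) : ℤ)) ∧
      Summable fun n : ℕ => (a : ℂ) ^ s * ∑' m : ℤ, epsteinTerm a b c s (m, ((n + 1 : ℕ) : ℤ)) := by
  obtain ⟨hZ, hf, -⟩ := epsteinZeta_eq_tsum_lines h hs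
  have ha0 : (a : ℂ) ≠ 0 := Complex.ofReal_ne_zero.2 h.a_pos.ne'
  have haa : (a : ℂ) ^ s * (a : ℂ) ^ (-s) = 1 := by
    rw [Complex.cpow_neg, mul_inv_cancel₀ (Complex.cpow_ne_zero_iff.2 (Or.inl ha0))]
  have heven : Function.Even fun n : ℤ => ∑' m : ℤ, epsteinTerm a b c s (m, n) :=
    fun n => tsum_line_neg a b c s n
  have hsucc : Summable fun n : ℕ => (a : ℂ) ^ s * ∑' m : ℤ, epsteinTerm a b c s (m, ((n + 1 : ℕ) : ℤ)) :=
    ((hf.comp_injective Nat.cast_injective).mul_left ((a : ℂ) ^ s) |>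
      (summable_nat_add_iff 1).2)
  refine ⟨?_, hsucc⟩
  rw [hZ, tsum_int_eq_zero_add_two_mul_tsum_pnat heven hf, tsum_line_zero h hs, nsmul_eq_mul,
    tsum_pnat_eq_tsum_succ (f := fun n : ℕ => ∑' m : ℤ, epsteinTerm a b c s (m, (n : ℤ))),
    tsum_mul_left]
  push_cast
  calc (a : ℂ) ^ s * (((a : ℂ) ^ (-s) * (2 * riemannZeta (2 * s)) +
        2 * ∑' n : ℕ, ∑' m : ℤ, epsteinTerm a b c s (m, (n : ℤ) + 1)) / 2)
      = ((a : ℂ) ^ s * (a : ℂ) ^ (-s)) * riemannZeta (2 * s) +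
          (a : ℂ) ^ s * ∑' n : ℕ, ∑' m : ℤ, epsteinTerm a b c s (m, (n : ℤ) + 1) := by ring
    _ = _ := by rw [haa, one_mul]

end Literature.Barriers.RiemannHypothesis
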